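import Mathlib
import HarnessLib
import Summits.HubbardSuperconductivity.HubbardSuperconductivity.Theorems.KLProgrammeKLRegimeTwoVolumeGridReadout

/-!
# Route `KLProgramme` — ENGINE child `KLRegimeEngineV16` (stmt-HubbardSuperconductivity-20236), `stub_twoLeg_scale0`, conjunct
# (E3f-AT)₀, spatial nested leg `hsp`: convolution on the torus and the COMPLEX site kernel of a self-energy string from its GRID
# representation (cell gate-hubbard-kl, seat hubbard-kl-k3c5-p2 g6, β′ lane, step (m5)-c, part 1)

Under the K-resummed reading (design (m1′): [tree] `HubbardCounterQuadraticResummation.selfEnergy_effAction_add_counterQuadratic`) the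
localised two-leg value is `Re E(p_k⃗) + Re[τ(p_k⃗)·Σ̃(k⃗)]` with EXPLICIT sampled symbols `E`, `τ` and the self-energy `Σ̃` of the purely quartic
theory with the resummed covariance.  The dressed term is a PRODUCT of a sampled symbol with a self-energy string; in position space its
site kernel is therefore a CONVOLUTION `τ̌ ∗ σ̃` of the sampled symbol's kernel with the complex site kernel
`σ̃(y) := torusFourierInv (k⃗ ↦ Σ̃((ω,k⃗),σ)) y` — which, for a grid representation `G = map S W`, is a phase-weighted two-leg GRID ROW
(p1b's identity [tree] `TwoLegFourier.sum_selfEnergy_map_gridSub_mul_torusChar`, no evenness needed at the complex level).  This file: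

* §1 torus convolution toolkit (inline convolution `y ↦ Σ_z A(z)B(y − z)`): the convolution theorem for `torusFourierInv` of a product
  (`torusFourierInv_mul_eq_conv`), Young's `ℓ¹` inequality (`sum_norm_conv_le`), bilinearity, the FIRST CENTRED MOMENT of a convolution
  (`sum_tnorm_norm_conv_le`: `M₁(A∗B) ≤ M₁(A)‖B‖₁ + ‖A‖₁M₁(B)`, `M₁ = Σ tnorm·‖·‖`) and far tails from first moments
  (`sum_far_norm_le_firstMoment_tnorm`: the non-lifted sites of the fine torus `Lf = b·Lc` have
  `tnorm ≥ (Lc−1)/2+1`, [tree] `le_tnorm_of_ne_clift`);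
* §2 the complex site kernel of a self-energy string from the grid: **`torusFourierInv_selfEnergy_map_gridSub_eq`** (exact:
  `σ(y) = (2/(βL²))·Σ_{p : x_{p₁} = x_{p₀} + y} e^{iω(τ_{p₀} − τ_{p₁})} kernel W 2 (p)`), **`torusFourierInv_selfEnergy_eq_row`** (base-point–independent
  rows, `|P| = N·L²`: `σ(y) = (2N/β)·R_W(o,y)`), its `ℓ¹` norm and first centred moment from the pinned grid sums
  (`sum_norm_siteKernel_le`, `sum_tnorm_norm_siteKernel_le`), and the nested two-volume form
  **`sum_norm_siteKernel_sub_clift_add_far_le_gridDefect`**: `Σ_{x̄}‖σ_c(x̄) − σ_f(clift x̄)‖ + Σ_{y ≠ clift(red y)}‖σ_f(y)‖ ≤ (2N/|β|)·[pinned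
  two-leg grid defect at the block-centre pin]` (the complex twin of `pinned_add_far_le_gridDefect`, reusing its row lemmas).

Proofs only; no definitions; nothing is asserted about the model.  References: Friedli–Velenik 2017 §10.4 (discrete Fourier analysis on the
torus); BGM 2006 §2.1 (2.5) (the position–time fields).
-/

noncomputable section

namespace Summit.HubbardSuperconductivity.HubbardSuperconductivity.Theorems.TwoVolumeDefect

set_option linter.dupNamespace false -- summit = problem name (single-conjunct summit), D-0017

open Finset Complex Literature.MathematicalPhysics.QuantumLattice Literature.Probability.LatticeModels GrassmannAlgebra
open Summit.HubbardSuperconductivity.HubbardSuperconductivity.Theorems.KLRegimeSplit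
open Summit.HubbardSuperconductivity.HubbardSuperconductivity.Theorems.TwoPointAssembly
open Summit.HubbardSuperconductivity.HubbardSuperconductivity.Theorems.TwoLegFourier
open scoped ComplexConjugate

/-! ## §1 Convolution on the discrete torus -/

section Conv

variable {d L : ℕ} [NeZero L]

/-- **Convolution theorem** on `(ℤ/Lℤ)^d`: `torusFourierInv (a·g) y = Σ_z torusFourierInv a z · torusFourierInv g (y − z)`. -/
theorem torusFourierInv_mul_eq_conv (a g : TorusSite d L → ℂ) (y : TorusSite d L) :
    torusFourierInv (fun k => a k * g k) y = ∑ z : TorusSite d L, torusFourierInv a z * torusFourierInv g (y - z) := by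
  classical
  have hL : ((L : ℂ) ^ d) ≠ 0 := natCast_pow_ne_zero
  simp_rw [torusFourierInv_eq_sum_torusChar]
  have h1 : ∀ z : TorusSite d L, (((L : ℂ) ^ d)⁻¹ * ∑ k, a k * torusChar k z) * (((L : ℂ) ^ d)⁻¹ * ∑ k', g k' * torusChar k' (y - z)) =
      ((L : ℂ) ^ d)⁻¹ * ((L : ℂ) ^ d)⁻¹ * ∑ k, ∑ k', a k * g k' * torusChar k' y * (torusChar k z * conj (torusChar k' z)) := by
    intro z
    rw [mul_mul_mul_comm, Finset.sum_mul_sum]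
    congr 1
    refine Finset.sum_congr rfl fun k _ => Finset.sum_congr rfl fun k' _ => ?_
    rw [torusChar_sub_right]
    ring
  rw [Finset.sum_congr rfl fun z _ => h1 z, ← Finset.mul_sum, Finset.sum_comm]
  have h2 : ∀ k : TorusSite d L, (∑ z : TorusSite d L, ∑ k', a k * g k' * torusChar k' y * (torusChar k z * conj (torusChar k' z))) =
      a k * g k * torusChar k y * (L : ℂ) ^ d := by
    intro k
    rw [Finset.sum_comm]
    simp_rw [← Finset.mul_sum, TorusBlock.sum_torusChar_mul_conj, mul_ite, mul_zero]
    rw [Finset.sum_ite_eq Finset.univ k, if_pos (Finset.mem_univ _)]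
  simp_rw [h2, ← Finset.sum_mul]
  field_simp

/-- Convolution is linear in the second factor: `A ∗ (B − B') = A ∗ B − A ∗ B'`. -/
theorem conv_sub_right (A B B' : TorusSite d L → ℂ) (y : TorusSite d L) :
    ∑ z : TorusSite d L, A z * (B (y - z) - B' (y - z)) =
      (∑ z : TorusSite d L, A z * B (y - z)) - ∑ z : TorusSite d L, A z * B' (y - z) := by
  rw [← Finset.sum_sub_distrib]
  refine Finset.sum_congr rfl fun z _ => ?_
  ring

/-- **Young's `ℓ¹` inequality** on the torus: `Σ_y ‖Σ_z A(z)B(y−z)‖ ≤ (Σ_z ‖A z‖)·(Σ_w ‖B w‖)`. -/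
theorem sum_norm_conv_le (A B : TorusSite d L → ℂ) :
    ∑ y : TorusSite d L, ‖∑ z : TorusSite d L, A z * B (y - z)‖ ≤ (∑ z : TorusSite d L, ‖A z‖) * ∑ w : TorusSite d L, ‖B w‖ := by
  calc ∑ y : TorusSite d L, ‖∑ z : TorusSite d L, A z * B (y - z)‖
      ≤ ∑ y : TorusSite d L, ∑ z : TorusSite d L, ‖A z‖ * ‖B (y - z)‖ :=
        Finset.sum_le_sum fun y _ => (norm_sum_le _ _).trans (Finset.sum_le_sum fun z _ => (norm_mul_le _ _))
    _ = ∑ z : TorusSite d L, ‖A z‖ * ∑ y : TorusSite d L, ‖B (y - z)‖ := by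
        rw [Finset.sum_comm]
        refine Finset.sum_congr rfl fun z _ => ?_
        rw [Finset.mul_sum]
    _ = ∑ z : TorusSite d L, ‖A z‖ * ∑ w : TorusSite d L, ‖B w‖ := by
        refine Finset.sum_congr rfl fun z _ => ?_
        congr 1
        exact (Equiv.subRight z).sum_comp (fun w => ‖B w‖)
    _ = (∑ z : TorusSite d L, ‖A z‖) * ∑ w : TorusSite d L, ‖B w‖ := by rw [Finset.sum_mul]

/-- **Weighted Young for a subadditive weight**: if `0 ≤ w` and `w y ≤ w z + w (y − z)` for all `y, z`, then
`Σ_y w(y)‖(A∗B)(y)‖ ≤ (Σ w‖A‖)(Σ‖B‖) + (Σ‖A‖)(Σ w‖B‖)`. -/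
theorem sum_weight_norm_conv_le_of_subadditive (A B : TorusSite d L → ℂ) {w : TorusSite d L → ℝ} (hw0 : ∀ y, 0 ≤ w y)
    (hsub : ∀ y z, w y ≤ w z + w (y - z)) :
    ∑ y : TorusSite d L, w y * ‖∑ z : TorusSite d L, A z * B (y - z)‖ ≤
      (∑ z : TorusSite d L, w z * ‖A z‖) * (∑ v : TorusSite d L, ‖B v‖) +
        (∑ z : TorusSite d L, ‖A z‖) * ∑ v : TorusSite d L, w v * ‖B v‖ := by
  have hstep : ∀ y : TorusSite d L, w y * ‖∑ z : TorusSite d L, A z * B (y - z)‖ ≤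
      ∑ z : TorusSite d L, (w z * ‖A z‖ * ‖B (y - z)‖ + ‖A z‖ * (w (y - z) * ‖B (y - z)‖)) := by
    intro y
    calc w y * ‖∑ z : TorusSite d L, A z * B (y - z)‖ ≤ w y * ∑ z : TorusSite d L, ‖A z‖ * ‖B (y - z)‖ :=
          mul_le_mul_of_nonneg_left ((norm_sum_le _ _).trans (Finset.sum_le_sum fun z _ => norm_mul_le _ _)) (hw0 y)
      _ = ∑ z : TorusSite d L, w y * (‖A z‖ * ‖B (y - z)‖) := by rw [Finset.mul_sum]
      _ ≤ ∑ z : TorusSite d L, (w z + w (y - z)) * (‖A z‖ * ‖B (y - z)‖) :=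
          Finset.sum_le_sum fun z _ => mul_le_mul_of_nonneg_right (hsub y z) (mul_nonneg (norm_nonneg _) (norm_nonneg _))
      _ = ∑ z : TorusSite d L, (w z * ‖A z‖ * ‖B (y - z)‖ + ‖A z‖ * (w (y - z) * ‖B (y - z)‖)) :=
          Finset.sum_congr rfl fun z _ => by ring
  refine (Finset.sum_le_sum fun y _ => hstep y).trans (le_of_eq ?_)
  rw [Finset.sum_comm, Finset.sum_mul, Finset.sum_mul, ← Finset.sum_add_distrib]
  refine Finset.sum_congr rfl fun z _ => ?_
  rw [Finset.sum_add_distrib, ← Finset.mul_sum, ← Finset.mul_sum]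
  congr 1
  · congr 1
    exact (Equiv.subRight z).sum_comp (fun v => ‖B v‖)
  · congr 1
    exact (Equiv.subRight z).sum_comp (fun v => w v * ‖B v‖)

/-- The torus sup-norm of the centred representative is subadditive in the form `tnorm y ≤ tnorm z + tnorm (y − z)`. -/
theorem tnorm_le_tnorm_add_tnorm_sub (y z : TorusSite d L) : Torus.tnorm y ≤ Torus.tnorm z + Torus.tnorm (y - z) := by
  have h := Torus.tnorm_add_le z (y - z)
  rwa [add_sub_cancel] at h

/-- **The first centred moment of a convolution**: `Σ_y tnorm(y)·‖(A∗B)(y)‖ ≤ M₁(A)·‖B‖₁ + ‖A‖₁·M₁(B)`, `M₁(F) = Σ tnorm·‖F‖`. -/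
theorem sum_tnorm_norm_conv_le (A B : TorusSite d L → ℂ) :
    ∑ y : TorusSite d L, (Torus.tnorm y : ℝ) * ‖∑ z : TorusSite d L, A z * B (y - z)‖ ≤
      (∑ z : TorusSite d L, (Torus.tnorm z : ℝ) * ‖A z‖) * (∑ v : TorusSite d L, ‖B v‖) +
        (∑ z : TorusSite d L, ‖A z‖) * ∑ v : TorusSite d L, (Torus.tnorm v : ℝ) * ‖B v‖ :=
  sum_weight_norm_conv_le_of_subadditive A B (fun y => Nat.cast_nonneg _) fun y z => by
    exact_mod_cast tnorm_le_tnorm_add_tnorm_sub y z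

end Conv

section Far

variable {d b Lc Lf : ℕ} [NeZero Lc] [NeZero Lf]

/-- **The non-lifted sites of the fine torus are far, so their mass is paid by the first centred moment**:
`Σ_{y ≠ clift(red y)} ‖F y‖ ≤ M₁(F)/((Lc−1)/2+1)` for `Lf = b·Lc` (tnorm-currency form of [tree] `sum_far_norm_le_of_firstMoment`). -/
theorem sum_far_norm_le_firstMoment_tnorm (hL : Lf = b * Lc) (F : TorusSite d Lf → ℂ) :
    ∑ y ∈ univ.filter (fun y : TorusSite d Lf => Torus.proj Lf (Torus.cRep (fun i => (((y i).val : ℕ) : ZMod Lc))) ≠ y), ‖F y‖ ≤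
      (∑ y : TorusSite d Lf, (Torus.tnorm y : ℝ) * ‖F y‖) / (((Lc - 1) / 2 + 1 : ℕ) : ℝ) := by
  have hw : Monotone (fun k : ℕ => (k : ℝ)) := fun a b h => by
    show (a : ℝ) ≤ (b : ℝ)
    exact_mod_cast h
  have h := sum_far_norm_le_of_weighted hL F hw (fun k => Nat.cast_nonneg k) (by positivity) le_rfl
  simpa using h

end Far

/-! ## §2 The complex site kernel of a self-energy string from its grid representation -/

section Site

variable {L M : ℕ} [NeZero L] {P : Type*} [Fintype P] [DecidableEq P]

/-- **EXACT: the complex site kernel from the grid** — `σ(y) := torusFourierInv (k⃗ ↦ Σ_G((ω,k⃗),σ)) y`, `G = map S W`, equals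
`(2/(βL²))·Σ_{p : x_{p₀} − x_{p₁} + y = 0} e^{iω(τ_{p₀} − τ_{p₁})}·kernel W 2 ((p₀,σ,+),(p₁,σ,−))` (no evenness needed). -/
theorem torusFourierInv_selfEnergy_map_gridSub_eq [NeZero M] {β : ℝ} (hβ : β ≠ 0) (x : P → TorusSite 2 L) (τ : P → ℝ)
    (W : GrassmannAlgebra ℂ (GridLeg P)) (n : MatsubaraIdx M) (σ : Fin 2) (y : TorusSite 2 L) :
    torusFourierInv (fun k : TorusSite 2 L => selfEnergy L M β (ExteriorAlgebra.map (Matrix.toLin' (gridSubMatrix L M β x τ)) W) (n, k) σ) y =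
      ((2 / (β * (L : ℝ) ^ 2) : ℝ) : ℂ) * ∑ p : Fin 2 → P, if x (p 0) - x (p 1) + y = 0 then
        Complex.exp (((matsubaraFreq β M n * (τ (p 0) - τ (p 1)) : ℝ) : ℂ) * Complex.I) * kernel ℂ W 2 (fun i => ((p i, σ), i))
        else 0 := by
  rw [torusFourierInv_eq_sum_torusChar, sum_selfEnergy_map_gridSub_mul_torusChar hβ, ← mul_assoc]
  congr 1
  push_cast
  ring

/-- **Base-point–independent rows**: `σ(y) = (2N/β)·R_W(o, y)` when the phase-weighted rows do not depend on the base point and `|P| = N·L²`. -/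
theorem torusFourierInv_selfEnergy_eq_row [NeZero M] {β : ℝ} (hβ : β ≠ 0) {N : ℕ} (x : P → TorusSite 2 L) (τ : P → ℝ)
    (hP : Fintype.card P = N * L ^ 2) (W : GrassmannAlgebra ℂ (GridLeg P)) (n : MatsubaraIdx M) (σ : Fin 2) (o : P)
    (hrow : ∀ (p₀ : P) (y : TorusSite 2 L),
      (∑ p₁ : P, if x p₁ = x p₀ + y then
        Complex.exp (((matsubaraFreq β M n * (τ p₀ - τ p₁) : ℝ) : ℂ) * Complex.I) * kernel ℂ W 2 (fun i => ((![p₀, p₁] i, σ), i))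
        else 0) =
      ∑ p₁ : P, if x p₁ = x o + y then
        Complex.exp (((matsubaraFreq β M n * (τ o - τ p₁) : ℝ) : ℂ) * Complex.I) * kernel ℂ W 2 (fun i => ((![o, p₁] i, σ), i))
        else 0)
    (y : TorusSite 2 L) :
    torusFourierInv (fun k : TorusSite 2 L => selfEnergy L M β (ExteriorAlgebra.map (Matrix.toLin' (gridSubMatrix L M β x τ)) W) (n, k) σ) y =
      ((2 * N / β : ℝ) : ℂ) * ∑ p₁ : P, if x p₁ = x o + y then
        Complex.exp (((matsubaraFreq β M n * (τ o - τ p₁) : ℝ) : ℂ) * Complex.I) * kernel ℂ W 2 (fun i => ((![o, p₁] i, σ), i))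
        else 0 := by
  rw [torusFourierInv_selfEnergy_map_gridSub_eq hβ x τ W n σ y]
  have hpair := sum_pair_eq_sum_row x (fun p : Fin 2 → P =>
    Complex.exp (((matsubaraFreq β M n * (τ (p 0) - τ (p 1)) : ℝ) : ℂ) * Complex.I) * kernel ℂ W 2 (fun i => ((p i, σ), i))) y
  rw [hpair]
  simp only [Matrix.cons_val_zero, Matrix.cons_val_one]
  simp_rw [hrow]
  rw [Finset.sum_const, Finset.card_univ, hP, nsmul_eq_mul, ← mul_assoc]
  congr 1
  have hL : (L : ℂ) ≠ 0 := by exact_mod_cast NeZero.ne L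
  have hβc : (β : ℂ) ≠ 0 := by exact_mod_cast hβ
  push_cast
  field_simp

/-- **`ℓ¹` norm of the site kernel from the pinned grid row** (base point at the origin):
`Σ_y ‖σ(y)‖ ≤ (2N/|β|)·Σ_{p₁} ‖kernel W 2 ((o,σ,+),(p₁,σ,−))‖`. -/
theorem sum_norm_siteKernel_le [NeZero M] {β : ℝ} (hβ : β ≠ 0) {N : ℕ} (x : P → TorusSite 2 L) (τ : P → ℝ)
    (hP : Fintype.card P = N * L ^ 2) (W : GrassmannAlgebra ℂ (GridLeg P)) (n : MatsubaraIdx M) (σ : Fin 2) {o : P} (hxo : x o = 0)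
    (hrow : ∀ (p₀ : P) (y : TorusSite 2 L),
      (∑ p₁ : P, if x p₁ = x p₀ + y then
        Complex.exp (((matsubaraFreq β M n * (τ p₀ - τ p₁) : ℝ) : ℂ) * Complex.I) * kernel ℂ W 2 (fun i => ((![p₀, p₁] i, σ), i))
        else 0) =
      ∑ p₁ : P, if x p₁ = x o + y then
        Complex.exp (((matsubaraFreq β M n * (τ o - τ p₁) : ℝ) : ℂ) * Complex.I) * kernel ℂ W 2 (fun i => ((![o, p₁] i, σ), i))
        else 0) :
    ∑ y : TorusSite 2 L,
        ‖torusFourierInv (fun k : TorusSite 2 L => selfEnergy L M β (ExteriorAlgebra.map (Matrix.toLin' (gridSubMatrix L M β x τ)) W) (n, k) σ) y‖ ≤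
      2 * N / |β| * ∑ p₁ : P, ‖kernel ℂ W 2 (fun i => ((![o, p₁] i, σ), i))‖ := by
  classical
  have hcoef : ‖((2 * N / β : ℝ) : ℂ)‖ = 2 * N / |β| := by
    rw [Complex.norm_real, Real.norm_eq_abs, abs_div, abs_of_nonneg (by positivity : (0 : ℝ) ≤ 2 * N)]
  have hterm : ∀ y : TorusSite 2 L,
      ‖torusFourierInv (fun k : TorusSite 2 L => selfEnergy L M β (ExteriorAlgebra.map (Matrix.toLin' (gridSubMatrix L M β x τ)) W) (n, k) σ) y‖ ≤
      2 * N / |β| * ∑ p₁ : P, if x p₁ = y then ‖kernel ℂ W 2 (fun i => ((![o, p₁] i, σ), i))‖ else 0 := by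
    intro y
    rw [torusFourierInv_selfEnergy_eq_row hβ x τ hP W n σ o hrow y, norm_mul, hcoef, hxo]
    simp_rw [zero_add]
    refine mul_le_mul_of_nonneg_left ((norm_sum_le _ _).trans (Finset.sum_le_sum fun p₁ _ => ?_)) (by positivity)
    by_cases h : x p₁ = y
    · rw [if_pos h, if_pos h, norm_mul, Complex.norm_exp_ofReal_mul_I, one_mul]
    · rw [if_neg h, if_neg h, norm_zero]
  refine (Finset.sum_le_sum fun y _ => hterm y).trans ?_
  rw [← Finset.mul_sum]
  refine mul_le_mul_of_nonneg_left (le_of_eq ?_) (by positivity)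
  rw [Finset.sum_comm]
  refine Finset.sum_congr rfl fun p₁ _ => ?_
  rw [Finset.sum_ite_eq Finset.univ (x p₁) (fun _ => ‖kernel ℂ W 2 (fun i => ((![o, p₁] i, σ), i))‖), if_pos (Finset.mem_univ _)]

/-- **First centred moment of the site kernel from the spatially weighted pinned grid row** (base point at the origin):
`Σ_y tnorm(y)·‖σ(y)‖ ≤ (2N/|β|)·Σ_{p₁} tnorm(x p₁)·‖kernel W 2 ((o,σ,+),(p₁,σ,−))‖`. -/
theorem sum_tnorm_norm_siteKernel_le [NeZero M] {β : ℝ} (hβ : β ≠ 0) {N : ℕ} (x : P → TorusSite 2 L) (τ : P → ℝ)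
    (hP : Fintype.card P = N * L ^ 2) (W : GrassmannAlgebra ℂ (GridLeg P)) (n : MatsubaraIdx M) (σ : Fin 2) {o : P} (hxo : x o = 0)
    (hrow : ∀ (p₀ : P) (y : TorusSite 2 L),
      (∑ p₁ : P, if x p₁ = x p₀ + y then
        Complex.exp (((matsubaraFreq β M n * (τ p₀ - τ p₁) : ℝ) : ℂ) * Complex.I) * kernel ℂ W 2 (fun i => ((![p₀, p₁] i, σ), i))
        else 0) =
      ∑ p₁ : P, if x p₁ = x o + y then
        Complex.exp (((matsubaraFreq β M n * (τ o - τ p₁) : ℝ) : ℂ) * Complex.I) * kernel ℂ W 2 (fun i => ((![o, p₁] i, σ), i))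
        else 0) :
    ∑ y : TorusSite 2 L, (Torus.tnorm y : ℝ) *
        ‖torusFourierInv (fun k : TorusSite 2 L => selfEnergy L M β (ExteriorAlgebra.map (Matrix.toLin' (gridSubMatrix L M β x τ)) W) (n, k) σ) y‖ ≤
      2 * N / |β| * ∑ p₁ : P, (Torus.tnorm (x p₁) : ℝ) * ‖kernel ℂ W 2 (fun i => ((![o, p₁] i, σ), i))‖ := by
  classical
  have hcoef : ‖((2 * N / β : ℝ) : ℂ)‖ = 2 * N / |β| := by
    rw [Complex.norm_real, Real.norm_eq_abs, abs_div, abs_of_nonneg (by positivity : (0 : ℝ) ≤ 2 * N)]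
  have hterm : ∀ y : TorusSite 2 L, (Torus.tnorm y : ℝ) *
      ‖torusFourierInv (fun k : TorusSite 2 L => selfEnergy L M β (ExteriorAlgebra.map (Matrix.toLin' (gridSubMatrix L M β x τ)) W) (n, k) σ) y‖ ≤
      2 * N / |β| * ∑ p₁ : P, if x p₁ = y then (Torus.tnorm (x p₁) : ℝ) * ‖kernel ℂ W 2 (fun i => ((![o, p₁] i, σ), i))‖ else 0 := by
    intro y
    rw [torusFourierInv_selfEnergy_eq_row hβ x τ hP W n σ o hrow y, norm_mul, hcoef, hxo]
    simp_rw [zero_add]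
    rw [mul_left_comm]
    refine mul_le_mul_of_nonneg_left ?_ (by positivity)
    calc (Torus.tnorm y : ℝ) * ‖∑ p₁ : P, if x p₁ = y then
            Complex.exp (((matsubaraFreq β M n * (τ o - τ p₁) : ℝ) : ℂ) * Complex.I) * kernel ℂ W 2 (fun i => ((![o, p₁] i, σ), i)) else 0‖
        ≤ (Torus.tnorm y : ℝ) * ∑ p₁ : P, ‖if x p₁ = y then
            Complex.exp (((matsubaraFreq β M n * (τ o - τ p₁) : ℝ) : ℂ) * Complex.I) * kernel ℂ W 2 (fun i => ((![o, p₁] i, σ), i)) else 0‖ :=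
          mul_le_mul_of_nonneg_left (norm_sum_le _ _) (Nat.cast_nonneg _)
      _ = ∑ p₁ : P, (Torus.tnorm y : ℝ) * ‖if x p₁ = y then
            Complex.exp (((matsubaraFreq β M n * (τ o - τ p₁) : ℝ) : ℂ) * Complex.I) * kernel ℂ W 2 (fun i => ((![o, p₁] i, σ), i)) else 0‖ :=
          Finset.mul_sum _ _ _
      _ = ∑ p₁ : P, if x p₁ = y then (Torus.tnorm (x p₁) : ℝ) * ‖kernel ℂ W 2 (fun i => ((![o, p₁] i, σ), i))‖ else 0 := by
          refine Finset.sum_congr rfl fun p₁ _ => ?_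
          by_cases h : x p₁ = y
          · rw [if_pos h, if_pos h, norm_mul, Complex.norm_exp_ofReal_mul_I, one_mul, h]
          · rw [if_neg h, if_neg h, norm_zero, mul_zero]
  refine (Finset.sum_le_sum fun y _ => hterm y).trans ?_
  rw [← Finset.mul_sum]
  refine mul_le_mul_of_nonneg_left (le_of_eq ?_) (by positivity)
  rw [Finset.sum_comm]
  refine Finset.sum_congr rfl fun p₁ _ => ?_
  rw [Finset.sum_ite_eq Finset.univ (x p₁) (fun _ => (Torus.tnorm (x p₁) : ℝ) * ‖kernel ℂ W 2 (fun i => ((![o, p₁] i, σ), i))‖),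
    if_pos (Finset.mem_univ _)]

end Site

/-! ## §3 Two nested volumes: the complex site kernels' pinned difference + far tail ≤ the pinned two-leg grid defect -/

section Nested

variable {b Lc Lf M : ℕ} [NeZero Lc] [NeZero Lf]
variable {P P' : Type*} [Fintype P] [DecidableEq P] [Fintype P'] [DecidableEq P']

/-- **COMPLEX SITE KERNELS AT TWO NESTED VOLUMES** (the twin of `pinned_add_far_le_gridDefect` without real parts or evenness): with the
block embedding `ι` onto the centred block and base point `o` at the origin,
`Σ_{x̄} ‖σ_c(x̄) − σ_f(clift x̄)‖ + Σ_{y ≠ clift(red y)} ‖σ_f(y)‖ ≤ (2N/|β|)·[Σ_{p₁} ‖W(o,p₁) − W'(ι o, ι p₁)‖ + Σ_{p₁' ∉ range ι} ‖W'(ι o, p₁')‖]`. -/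
theorem sum_norm_siteKernel_sub_clift_add_far_le_gridDefect [NeZero M] (hL : Lf = b * Lc) {β : ℝ} (hβ : β ≠ 0) {N : ℕ}
    (x : P → TorusSite 2 Lc) (τ : P → ℝ) (x' : P' → TorusSite 2 Lf) (τ' : P' → ℝ)
    (hP : Fintype.card P = N * Lc ^ 2) (hP' : Fintype.card P' = N * Lf ^ 2)
    (ι : P → P') (hι : Function.Injective ι) (hιx : ∀ p, x' (ι p) = Torus.proj Lf (Torus.cRep (x p))) (hιτ : ∀ p, τ' (ι p) = τ p)
    (hblock : ∀ p' : P', Torus.proj Lf (Torus.cRep (fun i => (((x' p' i).val : ℕ) : ZMod Lc))) = x' p' → p' ∈ Set.range ι)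
    {o : P} (hxo : x o = 0) (W : GrassmannAlgebra ℂ (GridLeg P)) (W' : GrassmannAlgebra ℂ (GridLeg P')) (n : MatsubaraIdx M) (σ : Fin 2)
    (hrow : ∀ (p₀ : P) (y : TorusSite 2 Lc),
      (∑ p₁ : P, if x p₁ = x p₀ + y then
        Complex.exp (((matsubaraFreq β M n * (τ p₀ - τ p₁) : ℝ) : ℂ) * Complex.I) * kernel ℂ W 2 (fun i => ((![p₀, p₁] i, σ), i))
        else 0) =
      ∑ p₁ : P, if x p₁ = x o + y then
        Complex.exp (((matsubaraFreq β M n * (τ o - τ p₁) : ℝ) : ℂ) * Complex.I) * kernel ℂ W 2 (fun i => ((![o, p₁] i, σ), i))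
        else 0)
    (hrow' : ∀ (p₀' : P') (y : TorusSite 2 Lf),
      (∑ p₁' : P', if x' p₁' = x' p₀' + y then
        Complex.exp (((matsubaraFreq β M n * (τ' p₀' - τ' p₁') : ℝ) : ℂ) * Complex.I) * kernel ℂ W' 2 (fun i => ((![p₀', p₁'] i, σ), i))
        else 0) =
      ∑ p₁' : P', if x' p₁' = x' (ι o) + y then
        Complex.exp (((matsubaraFreq β M n * (τ' (ι o) - τ' p₁') : ℝ) : ℂ) * Complex.I) * kernel ℂ W' 2 (fun i => ((![ι o, p₁'] i, σ), i))
        else 0) :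
    (∑ xbar : TorusSite 2 Lc,
        ‖torusFourierInv (fun k : TorusSite 2 Lc =>
            selfEnergy Lc M β (ExteriorAlgebra.map (Matrix.toLin' (gridSubMatrix Lc M β x τ)) W) (n, k) σ) xbar -
          torusFourierInv (fun k : TorusSite 2 Lf =>
            selfEnergy Lf M β (ExteriorAlgebra.map (Matrix.toLin' (gridSubMatrix Lf M β x' τ')) W') (n, k) σ)
            (Torus.proj Lf (Torus.cRep xbar))‖) +
      ∑ y ∈ univ.filter (fun y : TorusSite 2 Lf => Torus.proj Lf (Torus.cRep (fun i => (((y i).val : ℕ) : ZMod Lc))) ≠ y),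
        ‖torusFourierInv (fun k : TorusSite 2 Lf =>
            selfEnergy Lf M β (ExteriorAlgebra.map (Matrix.toLin' (gridSubMatrix Lf M β x' τ')) W') (n, k) σ) y‖ ≤
      2 * N / |β| *
        ((∑ p₁ : P, ‖kernel ℂ W 2 (fun i => ((![o, p₁] i, σ), i)) - kernel ℂ W' 2 (fun i => ((![ι o, ι p₁] i, σ), i))‖) +
          ∑ p₁' ∈ univ.filter (fun p₁' : P' => p₁' ∉ Set.range ι), ‖kernel ℂ W' 2 (fun i => ((![ι o, p₁'] i, σ), i))‖) := by
  classical
  have hc : ∀ ybar : TorusSite 2 Lc,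
      torusFourierInv (fun k : TorusSite 2 Lc =>
          selfEnergy Lc M β (ExteriorAlgebra.map (Matrix.toLin' (gridSubMatrix Lc M β x τ)) W) (n, k) σ) ybar =
        ((2 * N / β : ℝ) : ℂ) * (∑ p₁ : P, if x p₁ = x o + ybar then
          Complex.exp (((matsubaraFreq β M n * (τ o - τ p₁) : ℝ) : ℂ) * Complex.I) * kernel ℂ W 2 (fun i => ((![o, p₁] i, σ), i))
          else 0) :=
    fun ybar => torusFourierInv_selfEnergy_eq_row hβ x τ hP W n σ o hrow ybar
  have hc' : ∀ y : TorusSite 2 Lf,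
      torusFourierInv (fun k : TorusSite 2 Lf =>
          selfEnergy Lf M β (ExteriorAlgebra.map (Matrix.toLin' (gridSubMatrix Lf M β x' τ')) W') (n, k) σ) y =
        ((2 * N / β : ℝ) : ℂ) * (∑ p₁' : P', if x' p₁' = x' (ι o) + y then
          Complex.exp (((matsubaraFreq β M n * (τ' (ι o) - τ' p₁') : ℝ) : ℂ) * Complex.I) * kernel ℂ W' 2 (fun i => ((![ι o, p₁'] i, σ), i))
          else 0) :=
    fun y => torusFourierInv_selfEnergy_eq_row hβ x' τ' hP' W' n σ (ι o) hrow' y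
  set g : P → ℂ := fun p₁ => kernel ℂ W 2 (fun i => ((![o, p₁] i, σ), i)) with hg
  set g' : P' → ℂ := fun p₁' => kernel ℂ W' 2 (fun i => ((![ι o, p₁'] i, σ), i)) with hg'
  have hcoef : ‖((2 * N / β : ℝ) : ℂ)‖ = 2 * N / |β| := by
    rw [Complex.norm_real, Real.norm_eq_abs, abs_div, abs_of_nonneg (by positivity : (0 : ℝ) ≤ 2 * N)]
  -- (i) pinned
  have hpin : (∑ xbar : TorusSite 2 Lc,
      ‖torusFourierInv (fun k : TorusSite 2 Lc =>
          selfEnergy Lc M β (ExteriorAlgebra.map (Matrix.toLin' (gridSubMatrix Lc M β x τ)) W) (n, k) σ) xbar -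
        torusFourierInv (fun k : TorusSite 2 Lf =>
          selfEnergy Lf M β (ExteriorAlgebra.map (Matrix.toLin' (gridSubMatrix Lf M β x' τ')) W') (n, k) σ)
          (Torus.proj Lf (Torus.cRep xbar))‖) ≤
      2 * N / |β| * ∑ p₁ : P, ‖g p₁ - g' (ι p₁)‖ := by
    have hterm : ∀ xbar : TorusSite 2 Lc,
        ‖torusFourierInv (fun k : TorusSite 2 Lc =>
            selfEnergy Lc M β (ExteriorAlgebra.map (Matrix.toLin' (gridSubMatrix Lc M β x τ)) W) (n, k) σ) xbar -
          torusFourierInv (fun k : TorusSite 2 Lf =>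
            selfEnergy Lf M β (ExteriorAlgebra.map (Matrix.toLin' (gridSubMatrix Lf M β x' τ')) W') (n, k) σ)
            (Torus.proj Lf (Torus.cRep xbar))‖ ≤
        2 * N / |β| * ‖(∑ p₁ : P, if x p₁ = x o + xbar then
            Complex.exp (((matsubaraFreq β M n * (τ o - τ p₁) : ℝ) : ℂ) * Complex.I) * g p₁ else 0) -
          (∑ p₁ : P, if x p₁ = x o + xbar then
            Complex.exp (((matsubaraFreq β M n * (τ o - τ p₁) : ℝ) : ℂ) * Complex.I) * g' (ι p₁) else 0)‖ := by
      intro xbar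
      rw [hc xbar, hc' (Torus.proj Lf (Torus.cRep xbar)),
        row_fine_clift_eq hL x τ x' τ' ι hι hιx hιτ hblock hxo n g' xbar, ← mul_sub, norm_mul, hcoef]
    refine (Finset.sum_le_sum fun xbar _ => hterm xbar).trans ?_
    rw [← Finset.mul_sum]
    exact mul_le_mul_of_nonneg_left (sum_norm_row_sub_row_le x τ hxo n g (fun p₁ => g' (ι p₁))) (by positivity)
  -- (ii) far
  have hfarle : ∑ y ∈ univ.filter (fun y : TorusSite 2 Lf => Torus.proj Lf (Torus.cRep (fun i => (((y i).val : ℕ) : ZMod Lc))) ≠ y),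
      ‖torusFourierInv (fun k : TorusSite 2 Lf =>
          selfEnergy Lf M β (ExteriorAlgebra.map (Matrix.toLin' (gridSubMatrix Lf M β x' τ')) W') (n, k) σ) y‖ ≤
      2 * N / |β| * ∑ p₁' ∈ univ.filter (fun p₁' : P' => p₁' ∉ Set.range ι), ‖g' p₁'‖ := by
    have hterm : ∀ y : TorusSite 2 Lf,
        ‖torusFourierInv (fun k : TorusSite 2 Lf =>
            selfEnergy Lf M β (ExteriorAlgebra.map (Matrix.toLin' (gridSubMatrix Lf M β x' τ')) W') (n, k) σ) y‖ ≤
        2 * N / |β| * ‖∑ p₁' : P', if x' p₁' = x' (ι o) + y then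
            Complex.exp (((matsubaraFreq β M n * (τ' (ι o) - τ' p₁') : ℝ) : ℂ) * Complex.I) * g' p₁' else 0‖ := by
      intro y
      rw [hc' y, norm_mul, hcoef]
    refine (Finset.sum_le_sum fun y _ => hterm y).trans ?_
    rw [← Finset.mul_sum]
    exact mul_le_mul_of_nonneg_left (sum_far_norm_row_le hL x x' τ' ι hιx hxo n g') (by positivity)
  rw [mul_add]
  exact add_le_add hpin hfarle

end Nested

end Summit.HubbardSuperconductivity.HubbardSuperconductivity.Theorems.TwoVolumeDefect

end
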